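import Summits.QuantumFields.BalabanUV.Beta.RemainderExplicitDivGradSymbol

/-!
# Beta / RemainderExplicitDivGrad — BINDER-OWNERS row D4, ROAD P3 (co-owner #3, unit `b2b-balaban-beta-d4-p3`), skeleton leaf E3.3,
# THIRD THIRD, part 2: `d d*` OF THE TYPED `U = 1` MINIMISER COLUMN IS `O(N^{−(d+2)}·N^{−2})` POINTWISE WITH BLOCK-SCALE DECAY, LEVEL-UNIFORMLY —
# `|dz (codiff₁ wH-column) ν x| ≤ C · (N^5)⁻¹ · (N^2)⁻¹ · e^{−κ₀‖quo_N x‖∞}`, `N = Lc^{j+1}`, `d + 1 = 4`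

HONEST FRAMING (page 1 of everything the β sub-cell writes): discharging `BetaPertH` makes Bałaban's UV stability
UNCONDITIONAL — a real constructive-QFT result; it is NOT the continuum limit and NOT the Clay problem.  HONEST DEPENDENCY
(verbatim): «continuum YM on T⁴ ⇐ BetaPertH ∧ nine spine estimates (0/9 proved); BetaPertH ⇐ (D1) ∧ (D4) ∧ CAP+tail;
G-an2-4 gates asym, D1 and NE2/3/4.»  NOT IN PRINT; OUR PROOF.  `[folklore]` alias bookkeeping over the G-an2-4 swarm's fibre
currency (`GAN24.FineReadoutApriori.column_apriori`, `GAN24.FineReadoutSum.ampA_eq_Asol`, `GAN24.FibreBlockSolve.dot_Asol`,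
`GAN24.FineReadoutAlias`, `GAN24.FineReadoutGradient`, King's window-free sum `GAN24.AliasPointSum.sum_pointWeight_srep_le`) and the
position-space packaging of road P3's `RemainderExplicitGradient`; the fibre-side algebra (`dgMult`, `dgMult_eq_sum`, `stripHolo_dgMult`) is the
companion file `Beta/RemainderExplicitDivGradSymbol` (same namespace; split only for the 400-line lint).  No cited fact, no wall binder, no `def … : Prop`; nothing about
Bałaban's densities is asserted.  NOT summit progress.

ABSOLUTE RULE (cell charter, verbatim): "No internally-minted statement may enter as a cited fact. Every hypothesis is
either kernel-proved in this package or a verbatim quotation of a PUBLISHED theorem with page reference. The manuscript(s)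
under audit are NOT citable for their own disputed steps — they are the thing under adjudication; programme-internal
(2001/route/tribunal) claims are never citable."

## Why road P3 wants this (skeleton `HOME/beta/skeletons/D4-b2b-balaban-beta-d4-p3.md` §3 leaf E3.3; units note `UNITS-E4.md` §5)

[Balaban1987RG1] p. 272: «H_j satisfies the Landau gauge condition RD*H_j = 0, and we replace the operator D*D by D*D + DRD* =
D*D + DD* − DPD* = Δ^ξ_U − P₁ + (lower order, local operator)»; [Balaban1984PropagatorsI] p. 26 (1.44)/(1.49): `R = 1 −
Δ⁻¹Q′*(Q′Δ⁻²Q′*)⁻¹Q′Δ⁻¹`, the orthogonal projector onto `Δ N(Q′)`, so `R∂*A = 0 ⟺ Δ∂*A ∈ Range Q′*` — EXACTLY the typed weak gauge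
row (G) of `Beta/BlochFibreMatrix` («`Γ := codiff₁ (dz (codiff₁ A))` constant on the block»).  Hence for road P3's test configuration
`h = N^{d+2}·wH^{(N)}` (`KernelSpecInstance.wH_G`): `P(d*h) = d*h`, `P₁h = d P d* h = d d* h`, and the `|P₁𝐀|_X` component of the
(3.14)/(4.4) norm is `N²·N^{d+2}·|d d* wH|` in fine units (Δ^η = N²Δ).  This file proves `|d d* wH| ≲ N^{−(d+2)}·N^{−2}` level-
uniformly, i.e. that component is LEVEL-FREE; with `RemainderExplicitLaplacian.exists_curvAdj_curv_wH_decay` (`|d*d wH| ≲ N^{−7}`)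
also `|Δ wH| = |(d*d + dd*) wH| ≲ N^{−7}`: all four components of the (4.4) norm of the test configuration are level-free
(E3.1 `FineReadoutDecay.exists_wH_decay`, E3.2 `RemainderExplicitGradient.exists_dwH_decay`, E3.3 this file + `…Laplacian`).

## The mechanism (why a SECOND difference is available for THIS combination although King's sum at `α = 1` diverges)

In the Bloch fibre at coarse momentum `p`, the divergence of the minimiser column has alias amplitudes `∂̂♭(k_m)·Â_m`.  For
`m ≠ 0` the explicit block solution (`FibreBlockSolve.dot_Asol`) gives `∂̂♭(k_m)·Â_m = χ̂_m·c/L_m` EXACTLY — the transverse part of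
the column is divergence-free alias by alias; only the pure-gauge part driven by the block-constant gauge feed `c` survives, and
`‖c‖ ≤ (r₀³/N³)·A·N^{−(d+2)}` (`FineReadoutApriori.column_apriori`) carries THREE extra powers of `1/N`.  So the amplitude of
`d_ν d* wH` at alias `m ≠ 0` is `∂̂_ν(k_m)·χ̂_m·c/L_m` with `‖∂̂_ν(k_m)‖ ≤ 15F/N`, `‖χ̂_m‖ ≤ √12^D·Πwfold`, `1/‖L_m‖ ≤ N²/(2F²)`:
`≲ N·‖c‖·pointWeight 0 (srep m)` — King's exponent `α = 0 < 1`, summable, total `O(N^{−(d+2)}·N^{−2})`.  At the zero alias no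
division is made: `‖∂̂_ν(k_0)‖, ‖∂̂♭_κ(k_0)‖ ≤ (π+1)/N` and `‖Â_0‖ ≤ A·N^{−(d+2)}` give `O(N^{−(d+2)}·N^{−2})` directly.
-/

noncomputable section

open Complex Finset Matrix
open scoped BigOperators Real Matrix.Norms.L2Operator
open Literature.Probability.LatticeModels (TorusSite Torus.proj)
open Literature.MathematicalPhysics.QuantumFieldTheory.LatticeForm (quo repZ)
open Literature.MathematicalPhysics.QuantumFieldTheory.Balaban1983to89
open Literature.MathematicalPhysics.QuantumFieldTheory.Balaban1983to89.Beta
open Literature.MathematicalPhysics.QuantumFieldTheory.King1986 (aliasConst)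
open AffineAveraging (Site unitVec dz codiff₁)
open B4Strip (Strip reVec)
open B4ContourShift (BZ StripRegular latticeKernel supNorm latticeKernel_decay integrand)
open B4Green244 (phaseC latticeKernel_phase_mul latticeKernel_sum_mul)
open BlochFibreMatrix (Idx stencil pieceMatrix eq_repZ_add_zsmul_quo)
open FibreInverseDecay (trigPolySymbol StripHolo cphase stripHolo_cphase stripHolo_const)
open KernelSpecInstance (wH)
open Summit.QuantumFields.BalabanUV.Beta.GAN24.ArrowOperator (arrowMat)
open Summit.QuantumFields.BalabanUV.Beta.GAN24.ArrowScaling (scaledArrow radI radO radI_pos radO_pos)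
open Summit.QuantumFields.BalabanUV.Beta.GAN24.StripLegApriori (radO_zero_le_two_pi)
open Summit.QuantumFields.BalabanUV.Beta.GAN24.CombesThomasFibre (fibInv wH_eq_re_latticeKernel)
open Summit.QuantumFields.BalabanUV.Beta.GAN24.StripRegularPackaging (stripRegular_of_stripHolo stripHolo_fibInv)
open Summit.QuantumFields.BalabanUV.Beta.GAN24.FibreDetStripHolds (exists_strip strip_mono)
open Summit.QuantumFields.BalabanUV.Beta.GAN24.FibreSymbols (pw dhat dflat lapSym pw_add pw_add_unitVec pw_sub_unitVec)
open Summit.QuantumFields.BalabanUV.Beta.GAN24.FibreBlockSolve (dot Asol dot_Asol)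
open Summit.QuantumFields.BalabanUV.Beta.GAN24.FibreDFT (kFine pw_zero_site)
open Summit.QuantumFields.BalabanUV.Beta.GAN24.FibreDFTDictionary (ampA boxData_inl_eq_sum)
open Summit.QuantumFields.BalabanUV.Beta.GAN24.FibreArrow (dot_dflat_dhat)
open Summit.QuantumFields.BalabanUV.Beta.GAN24.AliasObjects (kAl dAl dbAl chiAl sbAl LAl)
open Summit.QuantumFields.BalabanUV.Beta.GAN24.AliasWeightsSum (lapR lapR_nonneg)
open Summit.QuantumFields.BalabanUV.Beta.GAN24.AliasReindex (srep)
open Summit.QuantumFields.BalabanUV.Beta.GAN24.AliasWeights (kfine)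
open Summit.QuantumFields.BalabanUV.Beta.GAN24.StripAliasBounds (norm_dbAl_le)
open Summit.QuantumFields.BalabanUV.Beta.GAN24.AliasPointSum (pointWeight pointWeight_nonneg sum_pointWeight_srep_le)
open Summit.QuantumFields.BalabanUV.Beta.GAN24.FineReadoutAlias (wfold Fsup wfold_nonneg one_le_Fsup lapR_pos
  half_lapR_le_norm_LAl norm_chiAl_le_prod inv_lapR_le norm_dot_le)
open Summit.QuantumFields.BalabanUV.Beta.GAN24.FineReadoutApriori (column_apriori)
open Summit.QuantumFields.BalabanUV.Beta.GAN24.FineReadoutSum (norm_pw_repZ_le ampA_eq_Asol)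
open Summit.QuantumFields.BalabanUV.Beta.GAN24.FineReadoutGradient (norm_dAl_le_Fsup norm_dAl_zero_le pointWeight_zero_eq)
open Summit.QuantumFields.BalabanUV.Beta.GAN24.FineReadoutDecay (aliasConst_nonneg)
open Summit.QuantumFields.BalabanUV.Beta.RemainderExplicitGradient (pw_kFine_neg_zsmul)

namespace Summit.QuantumFields.BalabanUV.Beta.RemainderExplicitDivGrad

section StripBound

variable {d N : ℕ} [NeZero N] {p : Fin (d + 1) → ℂ} {η : ℝ}

/-- [folklore] The King factor of the `d d*` bound: `(d+1)(π+1)² + (15/2)·√12^{d+1}·R₀³·C₀`, `C₀ = (3π)·3^{d+1}·aliasConst (d+1) 0`. -/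
def dgKingFactor (d : ℕ) (R0 : ℝ) : ℝ :=
  (d + 1 : ℕ) * (π + 1) ^ 2 + 15 / 2 * Real.sqrt 12 ^ (d + 1) * R0 ^ 3 * ((3 * π) ^ (1 - (0 : ℝ)) * (3 : ℝ) ^ (d + 1) * aliasConst (d + 1) 0)

/-- [folklore] THE SUP BOUND OF THE `d d*` MULTIPLIER at block side `N`: `dgM = e^{(d+1)η}·A·(N^{d+2})⁻¹·(N²)⁻¹·dgKingFactor d R₀`. -/
def dgM (d N : ℕ) (η A R0 : ℝ) : ℝ :=
  Real.exp ((d + 1) * η) * A * ((N : ℝ) ^ (d + 1 + 1))⁻¹ * ((N : ℝ) ^ 2)⁻¹ * dgKingFactor d R0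

omit [NeZero N] in
/-- [folklore] `dgKingFactor` is nonnegative and monotone in the radius envelope on `[0, ∞)`. -/
theorem dgKingFactor_mono {R0 R0' : ℝ} (h0 : 0 ≤ R0) (h : R0 ≤ R0') : dgKingFactor d R0 ≤ dgKingFactor d R0' := by
  unfold dgKingFactor
  have hC0 : 0 ≤ (3 * π) ^ (1 - (0 : ℝ)) * (3 : ℝ) ^ (d + 1) * aliasConst (d + 1) 0 :=
    mul_nonneg (by positivity) (aliasConst_nonneg (Nat.succ_pos d) (by norm_num))
  have h3 : R0 ^ 3 ≤ R0' ^ 3 := pow_le_pow_left₀ h0 h 3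
  have hK : 0 ≤ 15 / 2 * Real.sqrt 12 ^ (d + 1) := by positivity
  have h1 : 15 / 2 * Real.sqrt 12 ^ (d + 1) * R0 ^ 3 * ((3 * π) ^ (1 - (0 : ℝ)) * (3 : ℝ) ^ (d + 1) * aliasConst (d + 1) 0)
      ≤ 15 / 2 * Real.sqrt 12 ^ (d + 1) * R0' ^ 3 * ((3 * π) ^ (1 - (0 : ℝ)) * (3 : ℝ) ^ (d + 1) * aliasConst (d + 1) 0) :=
    mul_le_mul_of_nonneg_right (mul_le_mul_of_nonneg_left h3 hK) hC0
  linarith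

omit [NeZero N] in
/-- [folklore] `0 ≤ dgKingFactor d R₀` for `R₀ ≥ 0`. -/
theorem dgKingFactor_nonneg {R0 : ℝ} (h0 : 0 ≤ R0) : 0 ≤ dgKingFactor d R0 := by
  unfold dgKingFactor
  have hC0 : 0 ≤ (3 * π) ^ (1 - (0 : ℝ)) * (3 : ℝ) ^ (d + 1) * aliasConst (d + 1) 0 :=
    mul_nonneg (by positivity) (aliasConst_nonneg (Nat.succ_pos d) (by norm_num))
  positivity

omit [NeZero N] in
/-- [folklore] `0 ≤ dgM`. -/
theorem dgM_nonneg {A R0 : ℝ} (hA : 0 ≤ A) (hR0 : 0 ≤ R0) : 0 ≤ dgM d N η A R0 := by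
  unfold dgM
  have := dgKingFactor_nonneg (d := d) hR0
  positivity

/-- [folklore] **THE `d d*` MULTIPLIER AT A STRIP POINT WITH A SCALED A-PRIORI PAIR** (`|Re p_i| ≤ π`, `|Im p_i| ≤ η`, `0 ≤ η ≤ 1/4`,
`(3D/2+2)η ≤ 1/2`, `det F_N(p) ≠ 0`, radii `0 < r m`, `0 < r₀`, `‖(scaled arrow)⁻¹‖ ≤ A`):
`‖dgMult N l ν z p‖ ≤ e^{(d+1)η}·A·(N^{d+2})⁻¹·(N²)⁻¹·((d+1)(π+1)² + (15/2)·√12^{d+1}·r₀³·C₀)`. -/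
theorem norm_dgMult_le (hre : ∀ i, |(p i).re| ≤ π) (him : ∀ i, |(p i).im| ≤ η) (hη : 0 ≤ η) (hη4 : η ≤ 1 / 4)
    (hηD : (3 * (d + 1 : ℕ) / 2 + 2) * η ≤ 1 / 2)
    (hdet : (trigPolySymbol (stencil (d + 1)) (pieceMatrix (N := N)) p).det ≠ 0)
    {r : TorusSite (d + 1) N → ℝ} (hr : ∀ m, 0 < r m) {r0 : ℝ} (hr0 : 0 < r0) {A : ℝ} (hA0 : 0 ≤ A)
    (hU : IsUnit (arrowMat (scaledArrow N r r0 p))) (hA : ‖(arrowMat (scaledArrow N r r0 p))⁻¹‖ ≤ A)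
    (l ν : Fin (d + 1)) (z : Site (d + 1)) :
    ‖dgMult N l ν z p‖ ≤ dgM d N η A r0 := by
  classical
  rw [dgMult_eq_sum]
  set V : Idx (d + 1) N → ℂ := fun i => fibInv N i (Sum.inr (Sum.inr l)) p with hV
  set B : ℝ := A * ((N : ℝ) ^ (d + 1 + 1))⁻¹ with hB
  set C0 : ℝ := (3 * π) ^ (1 - (0 : ℝ)) * (3 : ℝ) ^ (d + 1) * aliasConst (d + 1) 0 with hC0
  set E : ℝ := Real.exp ((d + 1) * η) with hE
  have hN : (0 : ℝ) < N := by exact_mod_cast Nat.pos_of_ne_zero (NeZero.ne N)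
  have hB0 : 0 ≤ B := by positivity
  have hE0 : 0 ≤ E := (Real.exp_pos _).le
  have hη2 : η ≤ 1 / 2 := by linarith
  -- (U1)+A: the arrow vector of the column and the sharp ℓ² bounds
  obtain ⟨c, hx, hAmp, hφ, hc⟩ := column_apriori hr hr0 p hA0 hdet hU hA l
  set Cc : ℝ := r0 ^ 3 / (N : ℝ) ^ 3 * A * ((N : ℝ) ^ (d + 1 + 1))⁻¹ with hCc
  -- zero alias: no division, two symbols of size (π+1)/N
  have hterm0 : ‖dAl N p (0 : TorusSite (d + 1) N) ν * dot (dbAl N p 0) (ampA p V 0)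
        * pw (kFine p (0 : TorusSite (d + 1) N)) (repZ (Torus.proj N z))‖
      ≤ E * (B * ((d + 1 : ℕ) * (π + 1) ^ 2) * ((N : ℝ) ^ 2)⁻¹) := by
    rw [norm_mul, norm_mul]
    have hd := norm_dAl_zero_le (N := N) hre him hη2 ν
    have hdot : ‖dot (dbAl N p 0) (ampA p V 0)‖ ≤ (π + 1) / N * ((d + 1 : ℕ) * B) := by
      refine (norm_dot_le (fun κ => norm_dbAl_zero_le (N := N) hre him hη2 κ)).trans ?_
      refine mul_le_mul_of_nonneg_left ?_ (by positivity)
      calc ∑ κ, ‖ampA p V 0 κ‖ ≤ ∑ _κ : Fin (d + 1), B := Finset.sum_le_sum fun κ _ => hAmp 0 κ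
        _ = (d + 1 : ℕ) * B := by rw [Finset.sum_const, Finset.card_univ, Fintype.card_fin, nsmul_eq_mul]
    have hp := norm_pw_repZ_le him (0 : TorusSite (d + 1) N) (Torus.proj N z)
    have h1 : ‖dAl N p 0 ν‖ * ‖dot (dbAl N p 0) (ampA p V 0)‖ ≤ (π + 1) / N * ((π + 1) / N * ((d + 1 : ℕ) * B)) :=
      mul_le_mul hd hdot (norm_nonneg _) (by positivity)
    calc ‖dAl N p 0 ν‖ * ‖dot (dbAl N p 0) (ampA p V 0)‖ * ‖pw (kFine p 0) (repZ (Torus.proj N z))‖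
        ≤ ((π + 1) / N * ((π + 1) / N * ((d + 1 : ℕ) * B))) * E := mul_le_mul h1 hp (norm_nonneg _) (by positivity)
      _ = E * (B * ((d + 1 : ℕ) * (π + 1) ^ 2) * ((N : ℝ) ^ 2)⁻¹) := by field_simp
  -- nonzero aliases: the longitudinal content is the pure-gauge part `χ̂_m c / L_m`
  have hterm : ∀ m : TorusSite (d + 1) N, m ≠ 0 →
      ‖dAl N p m ν * dot (dbAl N p m) (ampA p V m) * pw (kFine p m) (repZ (Torus.proj N z))‖
        ≤ E * (B * ((N : ℝ) ^ 2)⁻¹ * (15 / 2 * Real.sqrt 12 ^ (d + 1) * r0 ^ 3) * pointWeight 0 (srep m)) := by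
    intro m hm
    have hΛ := lapR_pos (N := N) (p := p) hre hm
    have hhalf := half_lapR_le_norm_LAl (N := N) hre him hη hηD hm
    have hLm : lapSym (kFine p m) ≠ 0 := by
      intro h0
      have : ‖LAl N p m‖ = 0 := by rw [show LAl N p m = lapSym (kFine p m) from rfl, h0, norm_zero]
      linarith
    have hLdef : dot (dbAl N p m) (dAl N p m) = LAl N p m := dot_dflat_dhat (kFine p m)
    -- the longitudinal content of the amplitude
    have hlong : dot (dbAl N p m) (ampA p V m) = chiAl N p m * c / LAl N p m := by
      rw [ampA_eq_Asol hx m hLm]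
      exact dot_Asol _ _ _ hLm hLdef _
    rw [hlong]
    have hF : 0 < Fsup m := lt_of_lt_of_le one_pos (one_le_Fsup hm)
    have hW : 0 ≤ ∏ i, wfold m i := Finset.prod_nonneg fun i _ => wfold_nonneg m i
    have hd := norm_dAl_le_Fsup hre him hη2 hm ν
    have hχ := norm_chiAl_le_prod hre him hη hη4 m
    have hinv := inv_lapR_le hre hm
    have hLinv : ‖LAl N p m‖⁻¹ ≤ (N : ℝ) ^ 2 / (2 * Fsup m ^ 2) := by
      have hL0 : 0 < ‖LAl N p m‖ := lt_of_lt_of_le (half_pos hΛ) hhalf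
      rw [inv_le_comm₀ hL0 (by positivity)]
      have : (2 * Fsup m ^ 2) / (N : ℝ) ^ 2 ≤ lapR (kfine N (reVec p) m) / 2 := by
        rw [div_le_div_iff₀ (by positivity) (by norm_num)]
        have h4 : 4 * Fsup m ^ 2 ≤ (N : ℝ) ^ 2 * lapR (kfine N (reVec p) m) := by
          have := hinv
          rw [div_le_div_iff₀ hΛ (by positivity)] at this
          linarith
        nlinarith
      calc ((N : ℝ) ^ 2 / (2 * Fsup m ^ 2))⁻¹ = (2 * Fsup m ^ 2) / (N : ℝ) ^ 2 := by rw [inv_div]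
        _ ≤ lapR (kfine N (reVec p) m) / 2 := this
        _ ≤ ‖LAl N p m‖ := hhalf
    have hquot : ‖chiAl N p m * c / LAl N p m‖ ≤ (Real.sqrt 12 ^ (d + 1) * ∏ i, wfold m i) * Cc * ((N : ℝ) ^ 2 / (2 * Fsup m ^ 2)) := by
      rw [norm_div, norm_mul, div_eq_mul_inv]
      exact mul_le_mul (mul_le_mul hχ hc (norm_nonneg _) (by positivity)) hLinv (by positivity) (by positivity)
    have hp := norm_pw_repZ_le him m (Torus.proj N z)
    have hpw0 := pointWeight_zero_eq hm
    rw [norm_mul, norm_mul]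
    have h12 : ‖dAl N p m ν‖ * ‖chiAl N p m * c / LAl N p m‖
        ≤ (15 * Fsup m / N) * ((Real.sqrt 12 ^ (d + 1) * ∏ i, wfold m i) * Cc * ((N : ℝ) ^ 2 / (2 * Fsup m ^ 2))) :=
      mul_le_mul hd hquot (norm_nonneg _) (by positivity)
    have hre' : (15 * Fsup m / N) * ((Real.sqrt 12 ^ (d + 1) * ∏ i, wfold m i) * Cc * ((N : ℝ) ^ 2 / (2 * Fsup m ^ 2)))
        = B * ((N : ℝ) ^ 2)⁻¹ * (15 / 2 * Real.sqrt 12 ^ (d + 1) * r0 ^ 3) * pointWeight 0 (srep m) := by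
      rw [← hpw0, hCc, hB]
      field_simp
    rw [hre'] at h12
    have hP := pointWeight_nonneg (0 : ℝ) (srep m)
    calc ‖dAl N p m ν‖ * ‖chiAl N p m * c / LAl N p m‖ * ‖pw (kFine p m) (repZ (Torus.proj N z))‖
        ≤ (B * ((N : ℝ) ^ 2)⁻¹ * (15 / 2 * Real.sqrt 12 ^ (d + 1) * r0 ^ 3) * pointWeight 0 (srep m)) * E :=
          mul_le_mul h12 hp (norm_nonneg _) (by positivity)
      _ = _ := mul_comm _ _
  -- split and sum
  have hS0 := sum_pointWeight_srep_le (D := d + 1) (N := N) (Nat.succ_pos d) (α := 0) (by norm_num)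
  have hsplit : ‖∑ m : TorusSite (d + 1) N, dAl N p m ν * dot (dbAl N p m) (ampA p V m) * pw (kFine p m) (repZ (Torus.proj N z))‖
      ≤ E * (B * ((d + 1 : ℕ) * (π + 1) ^ 2) * ((N : ℝ) ^ 2)⁻¹)
        + ∑ m ∈ (Finset.univ : Finset (TorusSite (d + 1) N)).filter (fun m => m ≠ 0),
            E * (B * ((N : ℝ) ^ 2)⁻¹ * (15 / 2 * Real.sqrt 12 ^ (d + 1) * r0 ^ 3) * pointWeight 0 (srep m)) := by
    refine (norm_sum_le _ _).trans ?_
    rw [← Finset.add_sum_erase _ _ (Finset.mem_univ (0 : TorusSite (d + 1) N))]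
    refine add_le_add hterm0 ?_
    have hset : (Finset.univ : Finset (TorusSite (d + 1) N)).erase 0 = Finset.univ.filter (fun m => m ≠ 0) := by
      ext m; simp [Finset.mem_erase]
    rw [hset]
    exact Finset.sum_le_sum fun m hm => hterm m (Finset.mem_filter.1 hm).2
  have hsum : ∑ m ∈ (Finset.univ : Finset (TorusSite (d + 1) N)).filter (fun m => m ≠ 0),
      E * (B * ((N : ℝ) ^ 2)⁻¹ * (15 / 2 * Real.sqrt 12 ^ (d + 1) * r0 ^ 3) * pointWeight 0 (srep m))
      ≤ E * (B * ((N : ℝ) ^ 2)⁻¹ * (15 / 2 * Real.sqrt 12 ^ (d + 1) * r0 ^ 3) * C0) := by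
    rw [← Finset.mul_sum, ← Finset.mul_sum]
    apply mul_le_mul_of_nonneg_left _ hE0
    exact mul_le_mul_of_nonneg_left hS0 (by positivity)
  calc _ ≤ E * (B * ((d + 1 : ℕ) * (π + 1) ^ 2) * ((N : ℝ) ^ 2)⁻¹)
        + E * (B * ((N : ℝ) ^ 2)⁻¹ * (15 / 2 * Real.sqrt 12 ^ (d + 1) * r0 ^ 3) * C0) := hsplit.trans (add_le_add le_rfl hsum)
    _ = dgM d N η A r0 := by
        rw [dgM, dgKingFactor, hB, hE, hC0]; ring

/-- [folklore] **`StripRegular` OF THE `d d*` MULTIPLIER WITH THE `N⁻²`-IMPROVED BOUND** from a det-free strip carrying scaled a-priori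
pairs (inner or outer, border radius `≤ R₀`). -/
theorem stripRegular_dgMult {κ₀ A R0 : ℝ} (hκ0 : 0 < κ₀) (hκ4 : κ₀ ≤ 1 / 4) (hκD : (3 * (d + 1 : ℕ) / 2 + 2) * κ₀ ≤ 1 / 2)
    (hA : 0 ≤ A)
    (hdet : ∀ p ∈ Strip (d + 1) κ₀, (trigPolySymbol (stencil (d + 1)) (pieceMatrix (N := N)) p).det ≠ 0)
    (hpair : ∀ p ∈ Strip (d + 1) κ₀, ∃ (r : TorusSite (d + 1) N → ℝ) (r0 : ℝ), (∀ m, 0 < r m) ∧ 0 < r0 ∧ r0 ≤ R0 ∧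
      IsUnit (arrowMat (scaledArrow N r r0 p)) ∧ ‖(arrowMat (scaledArrow N r r0 p))⁻¹‖ ≤ A)
    (l ν : Fin (d + 1)) (z : Site (d + 1)) :
    StripRegular (dgMult N l ν z) κ₀ (dgM d N κ₀ A R0) := by
  refine stripRegular_of_stripHolo (stripHolo_dgMult hκ0.le hdet l ν z) fun p hp => ?_
  obtain ⟨r, r0, hr, hr0, hr0R, hU, hAi⟩ := hpair p hp
  have h := norm_dgMult_le (fun i => (hp i).1) (fun i => (hp i).2) hκ0.le hκ4 hκD (hdet p hp) hr hr0 hA hU hAi l ν z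
  refine h.trans ?_
  unfold dgM
  have hK := dgKingFactor_mono (d := d) hr0.le hr0R
  have hE : 0 ≤ Real.exp ((d + 1) * κ₀) * A * ((N : ℝ) ^ (d + 1 + 1))⁻¹ * ((N : ℝ) ^ 2)⁻¹ := by positivity
  exact mul_le_mul_of_nonneg_left hK hE

end StripBound

/-! ## §3 Position space: `dz (codiff₁ wH)` is the lattice kernel of the `d d*` multiplier -/

section Position

variable {d N : ℕ} [NeZero N]

/-- [folklore] **`wH κ l (z + v) = Re latticeKernel (shEntry v) (quo N z)`** — the phase-translation rule moves the block label of the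
displaced point back to `quo N z`. -/
theorem wH_shift_eq_re_latticeKernel (κ l : Fin (d + 1)) (z v : Site (d + 1)) :
    wH (N := N) κ l (z + v) = (latticeKernel (shEntry N κ l z v) (quo N z)).re := by
  rw [wH_eq_re_latticeKernel]
  congr 1
  unfold shEntry
  rw [latticeKernel_phase_mul, add_sub_cancel]

/-- [folklore] Finite superposition of lattice kernels (coefficient-free form of `B4Green244.latticeKernel_sum_mul`). -/
theorem latticeKernel_finset_sum {ι : Type*} (s : Finset ι) (G : ι → (Fin (d + 1) → ℂ) → ℂ) (x : Fin (d + 1) → ℤ)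
    (hint : ∀ i ∈ s, MeasureTheory.IntegrableOn (integrand (G i) x) (BZ (d + 1))) :
    latticeKernel (fun P => ∑ i ∈ s, G i P) x = ∑ i ∈ s, latticeKernel (G i) x := by
  have h := latticeKernel_sum_mul s (fun _ => (1 : ℂ)) G x hint
  simp only [one_mul] at h
  exact h

/-- [folklore] A strip-holomorphic multiplier (`κ₀ ≥ 0`) has an integrable integrand on the zone. -/
theorem integrableOn_of_stripHolo {G : (Fin (d + 1) → ℂ) → ℂ} {κ₀ : ℝ} (h : StripHolo G κ₀) (hκ : 0 ≤ κ₀) (x : Fin (d + 1) → ℤ) :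
    MeasureTheory.IntegrableOn (integrand G x) (BZ (d + 1)) := by
  obtain ⟨M, _, hM⟩ := h.exists_stripRegular
  exact hM.integrableOn hκ x

/-- [folklore] **`dz (codiff₁ wH-column) ν z = Re latticeKernel (dgMult) (quo N z)`** (the four-point stencil, entry by entry, and
linearity of the lattice kernel over the finitely many strip-holomorphic shifted entries). -/
theorem dz_codiff₁_wH_eq_re_latticeKernel {κ₀ : ℝ} (hκ : 0 ≤ κ₀)
    (hdet : ∀ p ∈ Strip (d + 1) κ₀, (trigPolySymbol (stencil (d + 1)) (pieceMatrix (N := N)) p).det ≠ 0)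
    (l ν : Fin (d + 1)) (z : Site (d + 1)) :
    dz (codiff₁ (fun κ w => wH (N := N) κ l w)) ν z = (latticeKernel (dgMult N l ν z) (quo N z)).re := by
  -- the right-hand side, entry by entry
  have hlin : latticeKernel (dgMult N l ν z) (quo N z)
      = ∑ κ : Fin (d + 1), ∑ j : Fin 4, sgn4 j * latticeKernel (shEntry N κ l z (disp ν κ j)) (quo N z) := by
    unfold dgMult
    rw [latticeKernel_finset_sum]
    · refine Finset.sum_congr rfl fun κ _ => ?_
      exact latticeKernel_sum_mul _ _ _ _ fun j _ => integrableOn_of_stripHolo (stripHolo_shEntry hκ hdet κ l z _) hκ _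
    · intro κ _
      refine integrableOn_of_stripHolo (stripHolo_finset_sum _ fun j _ => ?_) hκ _
      exact (stripHolo_const (sgn4 j) κ₀).mul (stripHolo_shEntry hκ hdet κ l z (disp ν κ j))
  rw [hlin, Complex.re_sum]
  -- the left-hand side, entry by entry
  simp only [dz, codiff₁]
  rw [← Finset.sum_sub_distrib]
  refine Finset.sum_congr rfl fun κ _ => ?_
  rw [Complex.re_sum, Fin.sum_univ_four]
  simp only [sgn4, disp, Matrix.cons_val_zero, Matrix.cons_val_one, Matrix.cons_val_two, Matrix.cons_val_three,
    Matrix.head_cons, Matrix.tail_cons, one_mul, neg_mul, Complex.neg_re]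
  have e1 : wH (N := N) κ l (z + unitVec ν - unitVec κ) = (latticeKernel (shEntry N κ l z (unitVec ν - unitVec κ)) (quo N z)).re := by
    rw [← wH_shift_eq_re_latticeKernel, add_sub_assoc]
  have e2 : wH (N := N) κ l (z + unitVec ν) = (latticeKernel (shEntry N κ l z (unitVec ν)) (quo N z)).re :=
    wH_shift_eq_re_latticeKernel κ l z (unitVec ν)
  have e3 : wH (N := N) κ l (z - unitVec κ) = (latticeKernel (shEntry N κ l z (-unitVec κ)) (quo N z)).re := by
    rw [← wH_shift_eq_re_latticeKernel, sub_eq_add_neg]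
  have e4 : wH (N := N) κ l z = (latticeKernel (shEntry N κ l z 0) (quo N z)).re := by
    rw [← wH_shift_eq_re_latticeKernel, add_zero]
  rw [e1, e2, e3, e4]
  ring

/-- [folklore] **THE `d d*` BOUND AT BLOCK SIDE `N`** (Paley–Wiener on the block label):
`|dz (codiff₁ wH-column l) ν z| ≤ dgM · e^{−κ₀‖quo N z‖∞}` for EVERY fine point `z` and direction `ν`. -/
theorem abs_dz_codiff₁_wH_le {κ₀ A R0 : ℝ} (hκ0 : 0 < κ₀) (hκ4 : κ₀ ≤ 1 / 4) (hκD : (3 * (d + 1 : ℕ) / 2 + 2) * κ₀ ≤ 1 / 2)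
    (hA : 0 ≤ A)
    (hdet : ∀ p ∈ Strip (d + 1) κ₀, (trigPolySymbol (stencil (d + 1)) (pieceMatrix (N := N)) p).det ≠ 0)
    (hpair : ∀ p ∈ Strip (d + 1) κ₀, ∃ (r : TorusSite (d + 1) N → ℝ) (r0 : ℝ), (∀ m, 0 < r m) ∧ 0 < r0 ∧ r0 ≤ R0 ∧
      IsUnit (arrowMat (scaledArrow N r r0 p)) ∧ ‖(arrowMat (scaledArrow N r r0 p))⁻¹‖ ≤ A)
    (l ν : Fin (d + 1)) (z : Site (d + 1)) :
    |dz (codiff₁ (fun κ w => wH (N := N) κ l w)) ν z| ≤ dgM d N κ₀ A R0 * Real.exp (-(κ₀ * supNorm (quo N z))) := by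
  rw [dz_codiff₁_wH_eq_re_latticeKernel hκ0.le hdet l ν z]
  refine (Complex.abs_re_le_norm _).trans ?_
  exact latticeKernel_decay (stripRegular_dgMult hκ0 hκ4 hκD hA hdet hpair l ν z) hκ0.le _

end Position

/-! ## §4 `d = 3`: the level-uniform `d d*` bound, unconditionally, from road P1's (U1)+A -/

section Four

variable {Lc : ℕ} [NeZero Lc]

/-- [folklore] **SKELETON LEAF E3.3 (THIRD THIRD) OF ROAD P3, UNCONDITIONAL AT `d + 1 = 4`**: ONE rate `κ₀ > 0` and ONE constant `C`
such that for EVERY level `N = Lc^(j+1)`, every fine point `z`, every source direction `l` and every lattice direction `ν`,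
`|dz (codiff₁ (wH-column l)) ν z| ≤ C · ((Lc^(j+1))^5)⁻¹ · ((Lc^(j+1))^2)⁻¹ · e^{−κ₀‖quo (Lc^(j+1)) z‖∞}` — `d d*` of the fine minimiser
column of Bałaban's typed `U = 1` block-spin map is `O(N^{−(d+2)}·N^{−2})` pointwise with exponential decay on the BLOCK scale, uniformly
in the level (inputs: `GAN24.FibreDetStripHolds.exists_strip`, `GAN24.FineReadoutApriori.column_apriori`, `GAN24.FibreBlockSolve.dot_Asol`
BY NAME).  Read through the units dictionary of road P3 (`h = N^5·wH`, `Δ^η = N²·Δ`, `P₁ = d(1 − R)d*`, `R d* h = 0`): the `|P₁𝐀|_X`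
component of the (4.4)-norm of the test configuration is LEVEL-UNIFORMLY bounded, and with `RemainderExplicitLaplacian` so is `|Δ^η𝐀|_X`. -/
theorem exists_ddwH_decay :
    ∃ κ₀ C : ℝ, 0 < κ₀ ∧ 0 ≤ C ∧ ∀ (j : ℕ) (l ν : Fin 4) (z : Fin 4 → ℤ),
      |dz (codiff₁ (fun κ w => wH (N := Lc ^ (j + 1)) κ l w)) ν z|
        ≤ C * (((Lc ^ (j + 1) : ℕ) : ℝ) ^ 5)⁻¹ * ((((Lc ^ (j + 1) : ℕ) : ℝ)) ^ 2)⁻¹ *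
          Real.exp (-(κ₀ * supNorm (quo (Lc ^ (j + 1)) z))) := by
  obtain ⟨ρ₀, κ₀, A, hρ₀, hκ₀, _hκρ, hκ4, hA, hdet, hpair⟩ := exists_strip (d := 3) (Lc := Lc)
  -- shrink the strip so that E3A2's relative bound applies: (3·4/2 + 2)·κ₁ ≤ 1/2, i.e. κ₁ ≤ 1/16
  set κ₁ : ℝ := min κ₀ (1 / 16) with hκ₁
  have hκ₁0 : 0 < κ₁ := lt_min hκ₀ (by norm_num)
  have hκ₁le : κ₁ ≤ κ₀ := min_le_left _ _
  have hκ₁4 : κ₁ ≤ 1 / 4 := (min_le_right _ _).trans (by norm_num)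
  have hκ₁D : (3 * (3 + 1 : ℕ) / 2 + 2) * κ₁ ≤ 1 / 2 := by
    have := min_le_right κ₀ (1 / 16 : ℝ); push_cast; nlinarith
  set R0 : ℝ := 2 * π with hR0
  have hR0pos : 0 < R0 := by rw [hR0]; positivity
  refine ⟨κ₁, Real.exp ((3 + 1) * κ₁) * A * dgKingFactor 3 R0, hκ₁0, ?_, fun j l ν z => ?_⟩
  · have := dgKingFactor_nonneg (d := 3) hR0pos.le; positivity
  haveI : NeZero (Lc ^ (j + 1)) := ⟨pow_ne_zero _ (NeZero.ne Lc)⟩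
  have hdet₁ : ∀ p ∈ Strip (3 + 1) κ₁, (trigPolySymbol (stencil (3 + 1)) (pieceMatrix (N := Lc ^ (j + 1))) p).det ≠ 0 :=
    strip_mono hκ₁le (hdet j)
  have hpair₁ : ∀ p ∈ Strip (3 + 1) κ₁, ∃ (r : TorusSite (3 + 1) (Lc ^ (j + 1)) → ℝ) (r0 : ℝ), (∀ m, 0 < r m) ∧ 0 < r0 ∧ r0 ≤ R0 ∧
      IsUnit (arrowMat (scaledArrow (Lc ^ (j + 1)) r r0 p)) ∧ ‖(arrowMat (scaledArrow (Lc ^ (j + 1)) r r0 p))⁻¹‖ ≤ A := by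
    intro p hp
    have hq : ∀ i, |reVec p i| ≤ π := fun i => (hp i).1
    rcases strip_mono hκ₁le (hpair j) p hp with ⟨_, hU, hAi⟩ | ⟨_, _, hq0, hU, hAi⟩
    · refine ⟨radI (Lc ^ (j + 1)), 1, radI_pos, one_pos, ?_, hU, hAi⟩
      rw [hR0]; have := Real.pi_gt_three; linarith
    · exact ⟨radO (Lc ^ (j + 1)) (reVec p), radO (Lc ^ (j + 1)) (reVec p) 0, radO_pos hq hq0, radO_pos hq hq0 0,
        radO_zero_le_two_pi hq, hU, hAi⟩
  have h := abs_dz_codiff₁_wH_le (N := Lc ^ (j + 1)) hκ₁0 hκ₁4 hκ₁D hA hdet₁ hpair₁ l ν z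
  refine h.trans (le_of_eq ?_)
  unfold dgM
  push_cast
  ring

end Four

end Summit.QuantumFields.BalabanUV.Beta.RemainderExplicitDivGrad

end
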